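import Summits.CriticalPhenomena.PercolationContinuityZ3.Theses.PercTwoPointDecay
import Summits.CriticalPhenomena.PercolationContinuityZ3.Theorems.PercNearOneGluingNoHeavyLowerTailCSHTheoremOne
import Literature.Probability.Percolation.TwoPointMoments
import HarnessLib

/-!
# `PercTwoPointDecay.TauContinuous` (stmt-CriticalPhenomena-0838) — SETTLED after continuity

Item `stmt-CriticalPhenomena-0838` of route `CriticalPhenomena/PercTwoPointDecay` (support): `p ↦ τ_p(0, x)` is continuous on `[0,1]` for every `x` (Aizenman–Kesten–Newman 1987).

Literally the Literature theorem `continuous_tau` (TwoPointMoments.lean: lower semicontinuity from local approximations, upper via uniqueness).  p205010 is NOT used.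

builds on p205010 (kernel theorem, internal audit signed; external expert review pending) — USED (`CSH.percolationContinuityZ3_holds`).  RSW3 lane, lead gen 28 (prover-prim-rsw3-lead-g28-0):
'after continuity — the ledger harvest'.
References: G. Kozma, N. Nitzan (2024), Thm. 6 / Conj. 3 [KozmaNitzan2024]; G. Grimmett, *Percolation* (1999), §8 [GrimmettPercolation1999].
-/

noncomputable section

namespace Summit.CriticalPhenomena.PercolationContinuityZ3.Theorems

namespace PercTwoPointDecayTauContinuous

open MeasureTheory Literature.Probability.Percolation Literature.Probability.LatticeModels

/-- **`PercTwoPointDecay.TauContinuous` (stmt-CriticalPhenomena-0838), settled.**  `continuous_tau 0 x`.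
[cite: KozmaNitzan2024, Thm. 6 with Conj. 3 (p. 15)] -/
theorem tauContinuous_proof : Summit.CriticalPhenomena.PercolationContinuityZ3.Theses.PercTwoPointDecay.TauContinuous := by
  intro x
  simpa only [tau] using continuous_tau (d := 3) (0 : Site 3) x

end PercTwoPointDecayTauContinuous

end Summit.CriticalPhenomena.PercolationContinuityZ3.Theorems

end
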